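import Mathlib.Data.Finset.Card
import Mathlib.Data.Fintype.Basic
import Mathlib.Tactic
import HarnessLib

/-!
# QUANT lane R8 — the spine of a comb in ancestor-finset coordinates: levels, ranks, and the level of a relay

builds on p205010 (kernel theorem, internal audit signed; external expert review pending)

Support file (`--supports stmt-CriticalPhenomena-4575`), QUANT lane lead (gen 9), rung R8 of `run/shared/lean/prim/quant/LADDER.md`;
memo `prim-quant-lead-g9/LEAD-NOTES-G9.md` N20 — fourth file of the kernel proof of FAR (`Quant.FarTreeRow`) at EVERY layer on COMBS.
Pure finite combinatorics (no probability).  In the coordinates of `Quant.FarTreeRow` a relay `x` is reached iff its ancestor finset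
`P x` is open.  A COMB is described around a distinguished relay `a` (the least likely one): its SPINE is `P a`, assumed to be an
unglued chain —

  `(spine)`  for `y ∈ P a`: `y ∈ P y ⊆ P a`, and for `y, y' ∈ P a`: `y ∈ P y' ∨ y' ∈ P y`, `y ∈ P y' → P y ⊆ P y'`, `y ∈ P y' → y' ∈ P y → y = y'`;

every relay's spine part is down-closed (`y ∈ P z ∩ P a → P y ⊆ P z`), and the private parts `P z ∖ P a` of distinct relays are disjoint.
The LEVELS of the spine are `S k = {y ∈ P a | #(P y) ≤ k}` (`k = 0..d`, `d = #(P a)`), the LEVEL of a relay `z` is `#(P z ∩ P a)`.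

* `Quant.comb_spine_mem_iff_card_le` — on the spine, `y ∈ P y' ↔ #(P y) ≤ #(P y')`; `Quant.comb_spine_eq_of_card_eq` — equal ranks, equal gates.
* `Quant.comb_level_zero / _top / _mono` — `S 0 = ∅`, `S d = P a`, `S k ⊆ S k'` for `k ≤ k'`.
* `Quant.comb_spine_prefix_eq_level` — `P y = S #(P y)` for `y ∈ P a`;
  `Quant.comb_relay_inter_eq_level` — **`P z ∩ P a = S (level z)`**: a relay's prefix is its spine level plus its private part.
* `Quant.comb_level_succ_eq` — two consecutive levels differ by at most one gate: if `s ∈ S (k+1) ∖ S k` then `S (k+1) = S k ∪ {s}`.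
* `Quant.comb_exists_deepest_level` — for a weight `T ≤ π 0` there is a deepest level `m ≤ d` with `T ≤ π m` (`m = d` or `π (m+1) < T`).
[this work]
-/

namespace Summit.CriticalPhenomena.PercolationContinuityZ3.Theorems

namespace Quant

open Finset
open scoped Classical

variable {ι : Type*}

/-! ### The spine as a ranked chain -/

/-- On an unglued chain, `y ∈ P y' ↔ #(P y) ≤ #(P y')`. [this work] -/
theorem comb_spine_mem_iff_card_le (P : ι → Finset ι) (a : ι)
    (hsp : ∀ y ∈ P a, y ∈ P y ∧ P y ⊆ P a ∧ ∀ y' ∈ P a,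
      (y ∈ P y' ∨ y' ∈ P y) ∧ (y ∈ P y' → P y ⊆ P y') ∧ (y ∈ P y' → y' ∈ P y → y = y'))
    {y y' : ι} (hy : y ∈ P a) (hy' : y' ∈ P a) : y ∈ P y' ↔ (P y).card ≤ (P y').card := by
  obtain ⟨hyy, -, hrel⟩ := hsp y hy
  obtain ⟨hcomp, hsub, -⟩ := hrel y' hy'
  obtain ⟨-, -, hrel'⟩ := hsp y' hy'
  obtain ⟨-, hsub', -⟩ := hrel' y hy
  constructor
  · exact fun h => Finset.card_le_card (hsub h)
  · intro hcard
    rcases hcomp with h | h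
    · exact h
    · -- `y' ∈ P y`: then `P y' ⊆ P y` with no fewer elements, so `P y' = P y ∋ y`
      have heq : P y' = P y := Finset.eq_of_subset_of_card_le (hsub' h) hcard
      rw [heq]; exact hyy

/-- On an unglued chain, equal ranks mean equal gates. [this work] -/
theorem comb_spine_eq_of_card_eq (P : ι → Finset ι) (a : ι)
    (hsp : ∀ y ∈ P a, y ∈ P y ∧ P y ⊆ P a ∧ ∀ y' ∈ P a,
      (y ∈ P y' ∨ y' ∈ P y) ∧ (y ∈ P y' → P y ⊆ P y') ∧ (y ∈ P y' → y' ∈ P y → y = y'))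
    {y y' : ι} (hy : y ∈ P a) (hy' : y' ∈ P a) (hcard : (P y).card = (P y').card) : y = y' := by
  have h1 : y ∈ P y' := (comb_spine_mem_iff_card_le P a hsp hy hy').2 hcard.le
  have h2 : y' ∈ P y := (comb_spine_mem_iff_card_le P a hsp hy' hy).2 hcard.ge
  exact ((hsp y hy).2.2 y' hy').2.2 h1 h2

/-! ### Levels -/

/-- Level `0` is empty (every spine gate lies in its own prefix). [this work] -/
theorem comb_level_zero (P : ι → Finset ι) (a : ι)
    (hsp : ∀ y ∈ P a, y ∈ P y ∧ P y ⊆ P a ∧ ∀ y' ∈ P a,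
      (y ∈ P y' ∨ y' ∈ P y) ∧ (y ∈ P y' → P y ⊆ P y') ∧ (y ∈ P y' → y' ∈ P y → y = y')) :
    (P a).filter (fun y => (P y).card ≤ 0) = ∅ := by
  rw [Finset.filter_eq_empty_iff]
  intro y hy h
  have : 0 < (P y).card := Finset.card_pos.2 ⟨y, (hsp y hy).1⟩
  omega

/-- Level `d = #(P a)` is the whole spine. [this work] -/
theorem comb_level_top (P : ι → Finset ι) (a : ι)
    (hsp : ∀ y ∈ P a, y ∈ P y ∧ P y ⊆ P a ∧ ∀ y' ∈ P a,
      (y ∈ P y' ∨ y' ∈ P y) ∧ (y ∈ P y' → P y ⊆ P y') ∧ (y ∈ P y' → y' ∈ P y → y = y')) :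
    (P a).filter (fun y => (P y).card ≤ (P a).card) = P a := by
  rw [Finset.filter_eq_self]
  exact fun y hy => Finset.card_le_card (hsp y hy).2.1

/-- Levels are nested. [this work] -/
theorem comb_level_mono (P : ι → Finset ι) (a : ι) {k k' : ℕ} (h : k ≤ k') :
    (P a).filter (fun y => (P y).card ≤ k) ⊆ (P a).filter (fun y => (P y).card ≤ k') := by
  intro y hy
  rw [Finset.mem_filter] at hy ⊢
  exact ⟨hy.1, hy.2.trans h⟩

/-- A down-closed subset of the spine is the level of its own cardinality. [this work] -/
theorem comb_downClosed_eq_level (P : ι → Finset ι) (a : ι)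
    (hsp : ∀ y ∈ P a, y ∈ P y ∧ P y ⊆ P a ∧ ∀ y' ∈ P a,
      (y ∈ P y' ∨ y' ∈ P y) ∧ (y ∈ P y' → P y ⊆ P y') ∧ (y ∈ P y' → y' ∈ P y → y = y'))
    (I : Finset ι) (hI : I ⊆ P a) (hdown : ∀ y ∈ I, P y ⊆ I) :
    I = (P a).filter (fun y => (P y).card ≤ I.card) := by
  ext y
  rw [Finset.mem_filter]
  constructor
  · exact fun hy => ⟨hI hy, Finset.card_le_card (hdown y hy)⟩
  · rintro ⟨hya, hcard⟩
    by_contra hyI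
    -- every element of `I` lies in `P y`, and `y ∈ P y ∖ I`: too many elements
    have hsub : I ⊆ P y := by
      intro y' hy'
      rcases ((hsp y' (hI hy')).2.2 y hya).1 with h | h
      · exact h
      · exact absurd (hdown y' hy' h) hyI
    have : (insert y I).card ≤ (P y).card :=
      Finset.card_le_card (Finset.insert_subset (hsp y hya).1 hsub)
    rw [Finset.card_insert_of_notMem hyI] at this
    omega

/-- The prefix of a spine gate is the level of its rank: `P y = S #(P y)`. [this work] -/
theorem comb_spine_prefix_eq_level (P : ι → Finset ι) (a : ι)
    (hsp : ∀ y ∈ P a, y ∈ P y ∧ P y ⊆ P a ∧ ∀ y' ∈ P a,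
      (y ∈ P y' ∨ y' ∈ P y) ∧ (y ∈ P y' → P y ⊆ P y') ∧ (y ∈ P y' → y' ∈ P y → y = y'))
    {y : ι} (hy : y ∈ P a) : P y = (P a).filter (fun y' => (P y').card ≤ (P y).card) :=
  comb_downClosed_eq_level P a hsp (P y) (hsp y hy).2.1 fun y' hy' => ((hsp y' ((hsp y hy).2.1 hy')).2.2 y hy).2.1 hy'

/-- **The spine part of a relay is a level**: `P z ∩ P a = S #(P z ∩ P a)`. [this work] -/
theorem comb_relay_inter_eq_level (P : ι → Finset ι) (a : ι)
    (hsp : ∀ y ∈ P a, y ∈ P y ∧ P y ⊆ P a ∧ ∀ y' ∈ P a,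
      (y ∈ P y' ∨ y' ∈ P y) ∧ (y ∈ P y' → P y ⊆ P y') ∧ (y ∈ P y' → y' ∈ P y → y = y'))
    {z : ι} (hz : ∀ y ∈ P z, y ∈ P a → P y ⊆ P z) :
    P z ∩ P a = (P a).filter (fun y => (P y).card ≤ (P z ∩ P a).card) :=
  comb_downClosed_eq_level P a hsp (P z ∩ P a) Finset.inter_subset_right fun y hy =>
    Finset.subset_inter (hz y (Finset.mem_inter.1 hy).1 (Finset.mem_inter.1 hy).2) (hsp y (Finset.mem_inter.1 hy).2).2.1

/-- The level of a relay is at most `d`. [this work] -/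
theorem comb_relay_level_le (P : ι → Finset ι) (a z : ι) : (P z ∩ P a).card ≤ (P a).card :=
  Finset.card_le_card Finset.inter_subset_right

/-- A relay's prefix splits into its spine level and its private part. [this work] -/
theorem comb_relay_prefix_eq (P : ι → Finset ι) (a : ι)
    (hsp : ∀ y ∈ P a, y ∈ P y ∧ P y ⊆ P a ∧ ∀ y' ∈ P a,
      (y ∈ P y' ∨ y' ∈ P y) ∧ (y ∈ P y' → P y ⊆ P y') ∧ (y ∈ P y' → y' ∈ P y → y = y'))
    {z : ι} (hz : ∀ y ∈ P z, y ∈ P a → P y ⊆ P z) :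
    P z = (P a).filter (fun y => (P y).card ≤ (P z ∩ P a).card) ∪ (P z \ P a) := by
  rw [← comb_relay_inter_eq_level P a hsp hz, Finset.union_comm, Finset.sdiff_union_inter]

/-- Consecutive levels differ by at most one gate: if `s ∈ S (k+1) ∖ S k` then `S (k+1) = S k ∪ {s}`. [this work] -/
theorem comb_level_succ_eq (P : ι → Finset ι) (a : ι)
    (hsp : ∀ y ∈ P a, y ∈ P y ∧ P y ⊆ P a ∧ ∀ y' ∈ P a,
      (y ∈ P y' ∨ y' ∈ P y) ∧ (y ∈ P y' → P y ⊆ P y') ∧ (y ∈ P y' → y' ∈ P y → y = y'))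
    {k : ℕ} {s : ι} (hs : s ∈ (P a).filter (fun y => (P y).card ≤ k + 1))
    (hs' : s ∉ (P a).filter (fun y => (P y).card ≤ k)) :
    (P a).filter (fun y => (P y).card ≤ k + 1) = (P a).filter (fun y => (P y).card ≤ k) ∪ {s} := by
  rw [Finset.mem_filter] at hs
  have hsk : (P s).card = k + 1 := by
    have : ¬ ((P s).card ≤ k) := fun h => hs' (Finset.mem_filter.2 ⟨hs.1, h⟩)
    omega
  ext y
  rw [Finset.mem_union, Finset.mem_filter, Finset.mem_filter, Finset.mem_singleton]
  constructor
  · rintro ⟨hy, hle⟩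
    rcases Nat.lt_or_ge (P y).card (k + 1) with h | h
    · exact Or.inl ⟨hy, by omega⟩
    · exact Or.inr (comb_spine_eq_of_card_eq P a hsp hy hs.1 (by omega))
  · rintro (⟨hy, hle⟩ | rfl)
    · exact ⟨hy, by omega⟩
    · exact ⟨hs.1, hsk.le⟩

/-- The spine prefix of a gate `s` of rank `k+1` is the level `k+1`, and `s` is its new element. [this work] -/
theorem comb_spine_gate_of_rank (P : ι → Finset ι) (a : ι)
    (hsp : ∀ y ∈ P a, y ∈ P y ∧ P y ⊆ P a ∧ ∀ y' ∈ P a,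
      (y ∈ P y' ∨ y' ∈ P y) ∧ (y ∈ P y' → P y ⊆ P y') ∧ (y ∈ P y' → y' ∈ P y → y = y'))
    {k : ℕ} {s : ι} (hs : s ∈ P a) (hsk : (P s).card = k + 1) :
    s ∈ (P a).filter (fun y => (P y).card ≤ k + 1) ∧ s ∉ (P a).filter (fun y => (P y).card ≤ k) ∧
      P s = (P a).filter (fun y => (P y).card ≤ k + 1) := by
  refine ⟨Finset.mem_filter.2 ⟨hs, hsk.le⟩, fun h => by have := (Finset.mem_filter.1 h).2; omega, ?_⟩
  rw [comb_spine_prefix_eq_level P a hsp hs, hsk]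

/-- For a relay `z` and a spine gate `s`: `s ∈ P z` iff the rank of `s` is at most the level of `z`. [this work] -/
theorem comb_spine_mem_relay_iff (P : ι → Finset ι) (a : ι)
    (hsp : ∀ y ∈ P a, y ∈ P y ∧ P y ⊆ P a ∧ ∀ y' ∈ P a,
      (y ∈ P y' ∨ y' ∈ P y) ∧ (y ∈ P y' → P y ⊆ P y') ∧ (y ∈ P y' → y' ∈ P y → y = y'))
    {z : ι} (hz : ∀ y ∈ P z, y ∈ P a → P y ⊆ P z) {s : ι} (hs : s ∈ P a) :
    s ∈ P z ↔ (P s).card ≤ (P z ∩ P a).card := by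
  have key := comb_relay_inter_eq_level P a hsp hz
  constructor
  · intro h
    have : s ∈ P z ∩ P a := Finset.mem_inter.2 ⟨h, hs⟩
    rw [key, Finset.mem_filter] at this
    exact this.2
  · intro h
    have : s ∈ P z ∩ P a := by rw [key, Finset.mem_filter]; exact ⟨hs, h⟩
    exact (Finset.mem_inter.1 this).1

/-! ### The deepest admissible level for a weight -/

/-- For `T ≤ π 0` there is a deepest `m ≤ d` with `T ≤ π m`: either `m = d` or `π (m+1) < T`. [this work] -/
theorem comb_exists_deepest_level (π : ℕ → ℝ) (T : ℝ) (d : ℕ) (h0 : T ≤ π 0) :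
    ∃ m, m ≤ d ∧ T ≤ π m ∧ (m = d ∨ π (m + 1) < T) := by
  induction d with
  | zero => exact ⟨0, le_rfl, h0, Or.inl rfl⟩
  | succ d ih =>
    obtain ⟨m, hmd, hTm, hm⟩ := ih
    by_cases hnext : π (m + 1) < T
    · exact ⟨m, by omega, hTm, Or.inr hnext⟩
    · rcases hm with rfl | hlt
      · exact ⟨m + 1, le_rfl, not_lt.1 hnext, Or.inl rfl⟩
      · exact absurd hlt hnext

end Quant

end Summit.CriticalPhenomena.PercolationContinuityZ3.Theorems
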